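import Mathlib
import HarnessLib
import Summits.HubbardSuperconductivity.HubbardSuperconductivity.Theorems.KLProgrammeC4aPPKernelFarSRows
import Summits.HubbardSuperconductivity.HubbardSuperconductivity.Theorems.KLProgrammeC4aPPKernelFamilyNeg

/-!
# Route `KLProgramme` — crux C4a, S3 brick (B4) «(B4)-UMK1», «(U1)-FARS-ROWS» part 2: the smooth-floor far piece at NEGATIVE loop levels —
# the diagonal majorant row `hKn1` (same majorant as the max-floor family, so `hρ0 hρc hρtail` are `…FamilyNeg`'s lemmas verbatim)

Cell `gate-hubbard-kl`, seat hubbard-kl-k3c3-p1 (g17; row «δμ-flow with klAngularMean constant piece»).  For `Kr := ppFarKernelS β Λ κ lo` at a loop level `−s`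
(`s ∈ [lo,hi]`) and partner `u ≥ s/2`: `|∂ᵤA_s(−s,u)| ≤ (64·Cᶠ·Λ³/(s+2Λ)³ + Rᶠ·e^{−βs/2})·max(u−s,lo)⁻²`, `Cᶠ = κ₀(64B₂+120B₁+154) + κ₁(12B₁+9)`,
`Rᶠ = κ₀((β·lo)²+2) + κ₁(β·lo+1)` — EXACTLY the majorant of `abs_deriv_ppFamilyKernel_negLevel_le_majorant` (p688783), because the only profile-dependent input
is `|κ′(r)·∂ᵤr| ≤ κ₁/max(s,u)`, which the smooth ratio also satisfies (`|∂ᵤr| ≤ 1/(m̃ₛ+m̃ᵤ) ≤ 1/max(s,|u|)`).  Hence the rows `hρ0`, `hρc`, `hρtail` of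
`foldBox_law_rows'` for the smooth far piece are `familyMajorant_nonneg`, `continuousOn_familyMajorant`, `intervalIntegral_familyMajorant_tail_le` unchanged.
* `abs_deriv_ppFarKernelS_negLevel_le_majorant`, `abs_deriv_ppFarKernelS_negLevel_row` (the binder shape).
Pure real analysis; nothing asserts (C), K3, the window or superconductivity.
References: BGM 2006 §2.1 (2.2)–(2.5), §2.4 (2.36) [cite: BenfattoGiulianiMastropietro2006]; FST II CPAM 51 (1998) §3 [cite: FeldmanSalmhoferTrubowitz1998].
-/

noncomputable section

namespace Summit.HubbardSuperconductivity.HubbardSuperconductivity.Theorems.C4a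

set_option linter.dupNamespace false -- summit = problem name (single-conjunct summit), D-0017

open Real Filter Set
open scoped Topology
open Literature.MathematicalPhysics.QuantumLattice Literature.Analysis.SpecialFunctions

set_option maxHeartbeats 400000 in
/-- **ROW `hKn1` FOR THE SMOOTH FAR PIECE.**  `0 < β`, `0 < Λ`, `|χ′| ≤ B₁`, `|χ″| ≤ B₂`; `|κ| ≤ κ₀`, `|κ′| ≤ κ₁` on `[0,1]`; `0 < lo ≤ s`, `s/2 ≤ u` ⟹
`|deriv A_s(−s,·) u| ≤ (64·Cᶠ·Λ³/(s+2Λ)³ + Rᶠ·e^{−βs/2})·max(u−s,lo)⁻¹²`. [cite: BenfattoGiulianiMastropietro2006, §2.4 (2.36)] -/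
theorem abs_deriv_ppFarKernelS_negLevel_le_majorant {β Λ : ℝ} (hβ : 0 < β) (hΛ : 0 < Λ) {B₁ B₂ : ℝ} (hB₁ : ∀ x, |deriv salmhoferCutoff x| ≤ B₁)
    (hB₂ : ∀ x, |deriv (deriv salmhoferCutoff) x| ≤ B₂) {κ κ' : ℝ → ℝ} {κ₀ κ₁ : ℝ} (hκ : ∀ t, HasDerivAt κ (κ' t) t)
    (hκb : ∀ t ∈ Icc 0 1, |κ t| ≤ κ₀) (hκ'b : ∀ t ∈ Icc 0 1, |κ' t| ≤ κ₁) {lo s u : ℝ} (hlo : 0 < lo) (hs : lo ≤ s) (hu : s / 2 ≤ u) :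
    |deriv (fun v : ℝ => ppFarKernelS β Λ κ lo (-s) v) u| ≤
      (64 * (κ₀ * (64 * B₂ + 120 * B₁ + 154) + κ₁ * (12 * B₁ + 9)) * Λ ^ 3 / (s + 2 * Λ) ^ 3 +
          (κ₀ * ((β * lo) ^ 2 + 2) + κ₁ * (β * lo + 1)) * Real.exp (-(β / 2 * s))) * ((max (u - s) lo)⁻¹ ^ 2) := by
  have hB0 := salmhoferB₁_nonneg hB₁
  have hB20 : 0 ≤ B₂ := (abs_nonneg _).trans (hB₂ 0)
  have hκ₀ : 0 ≤ κ₀ := (abs_nonneg _).trans (hκb 0 (left_mem_Icc.2 zero_le_one))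
  have hκ₁ : 0 ≤ κ₁ := (abs_nonneg _).trans (hκ'b 0 (left_mem_Icc.2 zero_le_one))
  have hs0 : 0 < s := hlo.trans_le hs
  have hu0 : 0 < u := by linarith
  set C : ℝ := 64 * B₂ + 120 * B₁ + 154 with hC
  have hC0 : 0 ≤ C := by rw [hC]; positivity
  set M : ℝ := max (u - s) lo with hM
  have hMlo : lo ≤ M := le_max_right _ _
  have hM0 : 0 < M := hlo.trans_le hMlo
  rw [(hasDerivAt_ppFarKernelS_u hβ hΛ hB₁ hκ hlo (-s) u).deriv]
  -- sizes of the two profile factors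
  have hr := ppSmoothRatio_mem_Ioo hlo (-s) u
  have hk : |κ (ppSmoothRatio lo (-s) u)| ≤ κ₀ := hκb _ ⟨hr.1.le, hr.2.le⟩
  have hmaxabs : max |(-s)| |u| = max s u := by rw [abs_neg, abs_of_pos hs0, abs_of_pos hu0]
  have hS' : |κ' (ppSmoothRatio lo (-s) u) * (-(ppSmoothScale lo (-s) * (u / ppSmoothScale lo u)) / (ppSmoothScale lo (-s) + ppSmoothScale lo u) ^ 2)| ≤
      κ₁ * (max s u)⁻¹ := by
    rw [abs_mul]
    refine mul_le_mul (hκ'b _ ⟨hr.1.le, hr.2.le⟩) ?_ (abs_nonneg _) hκ₁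
    have h := (abs_ppSmoothRatioD1_le hlo (-s) u).trans (inv_ppSmoothScale_add_le_inv_max hlo (neg_ne_zero.2 hs0.ne') u)
    rwa [hmaxabs] at h
  -- geometry: `max(u−s,lo) ≤ max(s,u)`
  have hMle : M ≤ max s u := max_le (by linarith [le_max_right s u]) (hs.trans (le_max_left _ _))
  have hsu0 : 0 < max s u := hs0.trans_le (le_max_left _ _)
  have hinvM : (max s u)⁻¹ ≤ M⁻¹ := inv_anti₀ hM0 hMle
  -- (A) the `∂ᵤP·κ(r)` term: the diagonal majorant of the true kernel times `κ₀`
  have hA : |ppTrueKernelDu β Λ (-s) u * κ (ppSmoothRatio lo (-s) u)| ≤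
      κ₀ * (64 * C * Λ ^ 3 / (s + 2 * Λ) ^ 3 + ((β * lo) ^ 2 + 2) * Real.exp (-(β / 2 * s))) * M⁻¹ ^ 2 := by
    have hP' := abs_ppTrueKernelDu_negLevel_le_majorant hβ hΛ hB₁ hB₂ hlo hs hu
    rw [abs_mul]
    have h0 : 0 ≤ (64 * C * Λ ^ 3 / (s + 2 * Λ) ^ 3 + ((β * lo) ^ 2 + 2) * Real.exp (-(β / 2 * s))) * M⁻¹ ^ 2 := by positivity
    calc |ppTrueKernelDu β Λ (-s) u| * |κ (ppSmoothRatio lo (-s) u)|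
        ≤ (64 * C * Λ ^ 3 / (s + 2 * Λ) ^ 3 + ((β * lo) ^ 2 + 2) * Real.exp (-(β / 2 * s))) * M⁻¹ ^ 2 * κ₀ := mul_le_mul hP' hk (abs_nonneg _) h0
      _ = _ := by ring
  -- (B) the `P·κ′(r)·r′` term
  have hB : |ppTrueKernel β Λ (-s) u * (κ' (ppSmoothRatio lo (-s) u) *
      (-(ppSmoothScale lo (-s) * (u / ppSmoothScale lo u)) / (ppSmoothScale lo (-s) + ppSmoothScale lo u) ^ 2))| ≤
      κ₁ * (64 * (12 * B₁ + 9) * Λ ^ 3 / (s + 2 * Λ) ^ 3 + (β * lo + 1) * Real.exp (-(β / 2 * s))) * M⁻¹ ^ 2 := by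
    rw [abs_mul]
    have hpow0 : 0 ≤ 64 * (12 * B₁ + 9) * Λ ^ 3 / (s + 2 * Λ) ^ 3 := by positivity
    have hexp0 : 0 ≤ (β * lo + 1) * Real.exp (-(β / 2 * s)) := by positivity
    rcases le_or_gt s (2 * Λ) with hsΛ | hsΛ
    · -- shell regime: reflected value envelope
      have hP := abs_ppTrueKernel_negLevel_le_inv_max hβ hΛ hB₁ hs0 u
      rw [abs_of_pos hu0] at hP
      have hCle : (12 * B₁ + 9) ≤ 64 * (12 * B₁ + 9) * Λ ^ 3 / (s + 2 * Λ) ^ 3 := by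
        rw [le_div_iff₀ (by positivity)]
        have h3 : (s + 2 * Λ) ^ 3 ≤ (4 * Λ) ^ 3 := pow_le_pow_left₀ (by positivity) (by linarith) 3
        nlinarith
      calc |ppTrueKernel β Λ (-s) u| * |κ' (ppSmoothRatio lo (-s) u) *
            (-(ppSmoothScale lo (-s) * (u / ppSmoothScale lo u)) / (ppSmoothScale lo (-s) + ppSmoothScale lo u) ^ 2)|
          ≤ (12 * B₁ + 9) * (max s u)⁻¹ * (κ₁ * (max s u)⁻¹) := mul_le_mul hP hS' (abs_nonneg _) (by positivity)
        _ = κ₁ * (12 * B₁ + 9) * (max s u)⁻¹ ^ 2 := by ring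
        _ ≤ κ₁ * (64 * (12 * B₁ + 9) * Λ ^ 3 / (s + 2 * Λ) ^ 3) * M⁻¹ ^ 2 := by
            have h1 : (max s u)⁻¹ ^ 2 ≤ M⁻¹ ^ 2 := pow_le_pow_left₀ (inv_nonneg.2 hsu0.le) hinvM 2
            have h2 : κ₁ * (12 * B₁ + 9) ≤ κ₁ * (64 * (12 * B₁ + 9) * Λ ^ 3 / (s + 2 * Λ) ^ 3) := mul_le_mul_of_nonneg_left hCle hκ₁
            exact mul_le_mul h2 h1 (by positivity) (by positivity)
        _ ≤ κ₁ * (64 * (12 * B₁ + 9) * Λ ^ 3 / (s + 2 * Λ) ^ 3 + (β * lo + 1) * Real.exp (-(β / 2 * s))) * M⁻¹ ^ 2 := by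
            gcongr; linarith
    · -- thermal regime
      have hsfar : Λ < s := by linarith
      rcases le_or_gt (u - s) lo with hnear | hfar
      · have hMeq : M = lo := max_eq_right hnear
        have hP := abs_ppTrueKernel_negLevel_thermal_le hβ hΛ hsΛ hu
        have hS'' : |κ' (ppSmoothRatio lo (-s) u) * (-(ppSmoothScale lo (-s) * (u / ppSmoothScale lo u)) / (ppSmoothScale lo (-s) + ppSmoothScale lo u) ^ 2)| ≤
            κ₁ * lo⁻¹ := hS'.trans (mul_le_mul_of_nonneg_left (inv_anti₀ hlo (hs.trans (le_max_left _ _))) hκ₁)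
        rw [hMeq]
        calc |ppTrueKernel β Λ (-s) u| * |κ' (ppSmoothRatio lo (-s) u) *
              (-(ppSmoothScale lo (-s) * (u / ppSmoothScale lo u)) / (ppSmoothScale lo (-s) + ppSmoothScale lo u) ^ 2)|
            ≤ β * Real.exp (-(β / 2 * s)) * (κ₁ * lo⁻¹) := mul_le_mul hP hS'' (abs_nonneg _) (by positivity)
          _ = κ₁ * (β * lo * Real.exp (-(β / 2 * s))) * lo⁻¹ ^ 2 := by field_simp
          _ ≤ κ₁ * (64 * (12 * B₁ + 9) * Λ ^ 3 / (s + 2 * Λ) ^ 3 + (β * lo + 1) * Real.exp (-(β / 2 * s))) * lo⁻¹ ^ 2 := by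
              gcongr
              nlinarith [Real.exp_pos (-(β / 2 * s))]
      · have hMeq : M = u - s := max_eq_left hfar.le
        have hsu : s < u := by linarith
        have hP := abs_ppTrueKernel_negLevel_thermal_far_le hβ hΛ hsfar hsu
        have hexp : Real.exp (-(β * s)) ≤ Real.exp (-(β / 2 * s)) := Real.exp_le_exp.2 (by nlinarith)
        have hS'' : |κ' (ppSmoothRatio lo (-s) u) * (-(ppSmoothScale lo (-s) * (u / ppSmoothScale lo u)) / (ppSmoothScale lo (-s) + ppSmoothScale lo u) ^ 2)| ≤
            κ₁ * (u - s)⁻¹ :=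
          hS'.trans (mul_le_mul_of_nonneg_left (inv_anti₀ (by linarith) (by linarith [le_max_right s u] : u - s ≤ max s u)) hκ₁)
        rw [hMeq]
        calc |ppTrueKernel β Λ (-s) u| * |κ' (ppSmoothRatio lo (-s) u) *
              (-(ppSmoothScale lo (-s) * (u / ppSmoothScale lo u)) / (ppSmoothScale lo (-s) + ppSmoothScale lo u) ^ 2)|
            ≤ Real.exp (-(β * s)) * (u - s)⁻¹ * (κ₁ * (u - s)⁻¹) := mul_le_mul hP hS'' (abs_nonneg _) (by positivity)
          _ = κ₁ * Real.exp (-(β * s)) * (u - s)⁻¹ ^ 2 := by ring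
          _ ≤ κ₁ * Real.exp (-(β / 2 * s)) * (u - s)⁻¹ ^ 2 := by gcongr
          _ ≤ κ₁ * (64 * (12 * B₁ + 9) * Λ ^ 3 / (s + 2 * Λ) ^ 3 + (β * lo + 1) * Real.exp (-(β / 2 * s))) * (u - s)⁻¹ ^ 2 := by
              gcongr
              nlinarith [Real.exp_pos (-(β / 2 * s)), mul_pos hβ hlo]
  calc |ppTrueKernelDu β Λ (-s) u * κ (ppSmoothRatio lo (-s) u) + ppTrueKernel β Λ (-s) u * (κ' (ppSmoothRatio lo (-s) u) *
        (-(ppSmoothScale lo (-s) * (u / ppSmoothScale lo u)) / (ppSmoothScale lo (-s) + ppSmoothScale lo u) ^ 2))|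
      ≤ κ₀ * (64 * C * Λ ^ 3 / (s + 2 * Λ) ^ 3 + ((β * lo) ^ 2 + 2) * Real.exp (-(β / 2 * s))) * M⁻¹ ^ 2 +
          κ₁ * (64 * (12 * B₁ + 9) * Λ ^ 3 / (s + 2 * Λ) ^ 3 + (β * lo + 1) * Real.exp (-(β / 2 * s))) * M⁻¹ ^ 2 :=
        (abs_add_le _ _).trans (add_le_add hA hB)
    _ = (64 * (κ₀ * C + κ₁ * (12 * B₁ + 9)) * Λ ^ 3 / (s + 2 * Λ) ^ 3 + (κ₀ * ((β * lo) ^ 2 + 2) + κ₁ * (β * lo + 1)) * Real.exp (-(β / 2 * s))) *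
          M⁻¹ ^ 2 := by ring

/-- **ROW `hKn1` in the binder shape of `foldBox_law_rows'`.** [cite: BenfattoGiulianiMastropietro2006, §2.4 (2.36)] -/
theorem abs_deriv_ppFarKernelS_negLevel_row {β Λ : ℝ} (hβ : 0 < β) (hΛ : 0 < Λ) {B₁ B₂ : ℝ} (hB₁ : ∀ x, |deriv salmhoferCutoff x| ≤ B₁)
    (hB₂ : ∀ x, |deriv (deriv salmhoferCutoff) x| ≤ B₂) {κ κ' : ℝ → ℝ} {κ₀ κ₁ : ℝ} (hκ : ∀ t, HasDerivAt κ (κ' t) t)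
    (hκb : ∀ t ∈ Icc 0 1, |κ t| ≤ κ₀) (hκ'b : ∀ t ∈ Icc 0 1, |κ' t| ≤ κ₁) {lo hi : ℝ} (hlo : 0 < lo) :
    ∀ s ∈ Icc lo hi, ∀ u, s / 2 ≤ u → |deriv (fun v : ℝ => ppFarKernelS β Λ κ lo (-s) v) u| ≤
      (64 * (κ₀ * (64 * B₂ + 120 * B₁ + 154) + κ₁ * (12 * B₁ + 9)) * Λ ^ 3 / (s + 2 * Λ) ^ 3 +
          (κ₀ * ((β * lo) ^ 2 + 2) + κ₁ * (β * lo + 1)) * Real.exp (-(β / 2 * s))) * ((max (u - s) lo)⁻¹ ^ 2) :=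
  fun _ hs _ hu => abs_deriv_ppFarKernelS_negLevel_le_majorant hβ hΛ hB₁ hB₂ hκ hκb hκ'b hlo hs.1 hu

end Summit.HubbardSuperconductivity.HubbardSuperconductivity.Theorems.C4a

end
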